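/- Fleet lead `ym-wcr-19456-p1`, route `WeakCouplingRates`, crux `ColdBoxTwoPointFloorW` (stmt-QuantumFields-19608). -/
import Mathlib.MeasureTheory.Measure.Tilted
import Mathlib.MeasureTheory.Integral.Bochner.Basic
import HarnessLib

/-!
# Crux `ColdBoxTwoPointFloor(W)`, piece S3c-ii step 5 bookkeeping: a BOUNDED TILT `e^{W}`, `|W| ≤ w`, moves bounded expectations by
# `≤ M·(e^{2w} − 1)` and connected two-point functions by `≤ 3·M_f·M_g·(e^{2w} − 1)`

The sup-norm comparison step of the one-scale expansion: once the cold-wall box state (in the temporal-forest gauge, restricted to the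
small-field event, in the exponential chart) is written as a tilt `ν.tilted W` of its Gaussian reference `ν` by the non-Gaussian part
`W` of the action (cubic/quartic/BCH/Haar-Jacobian terms) with `sup |W| ≤ w`, the connected two-point function of bounded observables
differs from the Gaussian one by at most `3 M_f M_g (e^{2w} − 1) ≈ 6 M_f M_g w`.  Mathlib's `Measure.tilted` (density
`e^{W}/∫e^{W}dν`); lemmas: `integral_exp_mem_Icc` (normaliser in `[e^{−w}, e^{w}]`), `abs_tiltDensity_sub_one_le` (density within
`e^{2w} − 1` of `1`), `abs_integral_tilted_sub_le`, `abs_cov_tilted_sub_le`.  Companion of `…ColdBoxGoodEvent` (conditioning) and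
`…ColdBoxLargeFieldSU2` (large fields).  Elementary; everything proved; no definition; standard axioms.
-/

set_option autoImplicit false

noncomputable section

open MeasureTheory Real

namespace Summit.QuantumFields.YangMills.Theorems.WeakCouplingRates

variable {Ω : Type*} [MeasurableSpace Ω] {ν : Measure Ω} [IsProbabilityMeasure ν] {W : Ω → ℝ} {w : ℝ}

/-- The normaliser of a bounded tilt: `e^{−w} ≤ ∫ e^{W} dν ≤ e^{w}` if `|W| ≤ w`. -/
theorem integral_exp_mem_Icc (hWm : Measurable W) (hW : ∀ ω, |W ω| ≤ w) :
    exp (-w) ≤ ∫ ω, exp (W ω) ∂ν ∧ ∫ ω, exp (W ω) ∂ν ≤ exp w := by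
  have hint : Integrable (fun ω => exp (W ω)) ν := by
    refine Integrable.mono' (integrable_const (exp w)) (Real.measurable_exp.comp hWm).aestronglyMeasurable
      (ae_of_all _ fun ω => ?_)
    rw [Real.norm_eq_abs, abs_of_pos (exp_pos _)]
    exact exp_le_exp.2 (le_of_abs_le (hW ω))
  constructor
  · calc exp (-w) = ∫ _, exp (-w) ∂ν := by simp
      _ ≤ ∫ ω, exp (W ω) ∂ν := integral_mono (integrable_const _) hint fun ω =>
          exp_le_exp.2 (neg_le_of_abs_le (hW ω))
  · calc ∫ ω, exp (W ω) ∂ν ≤ ∫ _, exp w ∂ν := integral_mono hint (integrable_const _) fun ω =>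
          exp_le_exp.2 (le_of_abs_le (hW ω))
      _ = exp w := by simp

/-- The tilting density is within `e^{2w} − 1` of `1`: `|e^{W(ω)}/∫e^{W}dν − 1| ≤ e^{2w} − 1`. -/
theorem abs_tiltDensity_sub_one_le (hWm : Measurable W) (hW : ∀ ω, |W ω| ≤ w) (ω : Ω) :
    |exp (W ω) / ∫ ω', exp (W ω') ∂ν - 1| ≤ exp (2 * w) - 1 := by
  obtain ⟨hZ1, hZ2⟩ := integral_exp_mem_Icc (ν := ν) hWm hW
  set Z := ∫ ω', exp (W ω') ∂ν with hZ
  have hZ0 : 0 < Z := lt_of_lt_of_le (exp_pos _) hZ1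
  have hw0 : 0 ≤ w := (abs_nonneg _).trans (hW ω)
  have hup : exp (W ω) / Z ≤ exp (2 * w) := by
    rw [div_le_iff₀ hZ0]
    calc exp (W ω) ≤ exp w := exp_le_exp.2 (le_of_abs_le (hW ω))
      _ = exp (2 * w) * exp (-w) := by rw [← exp_add]; ring_nf
      _ ≤ exp (2 * w) * Z := mul_le_mul_of_nonneg_left hZ1 (exp_pos _).le
  have hlow : exp (-(2 * w)) ≤ exp (W ω) / Z := by
    rw [le_div_iff₀ hZ0]
    calc exp (-(2 * w)) * Z ≤ exp (-(2 * w)) * exp w := mul_le_mul_of_nonneg_left hZ2 (exp_pos _).le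
      _ = exp (-w) := by rw [← exp_add]; ring_nf
      _ ≤ exp (W ω) := exp_le_exp.2 (neg_le_of_abs_le (hW ω))
  rw [abs_le]
  constructor
  · -- 1 - e^{-2w} ≤ e^{2w} - 1
    have h1 : 1 - exp (-(2 * w)) ≤ exp (2 * w) - 1 := by
      have := add_one_le_exp (2 * w)
      have := add_one_le_exp (-(2 * w))
      nlinarith [exp_pos (2 * w), exp_pos (-(2 * w)), Real.exp_neg (2 * w)]
    linarith
  · linarith

/-- **A bounded tilt moves a bounded expectation by at most `M·(e^{2w} − 1)`.** -/
theorem abs_integral_tilted_sub_le (hWm : Measurable W) (hW : ∀ ω, |W ω| ≤ w) {g : Ω → ℝ}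
    (hg : Integrable g ν) {M : ℝ} (hM : ∀ ω, |g ω| ≤ M) :
    |(∫ ω, g ω ∂(ν.tilted W)) - ∫ ω, g ω ∂ν| ≤ M * (exp (2 * w) - 1) := by
  rw [integral_tilted]
  have hint : Integrable (fun ω => (exp (W ω) / ∫ ω', exp (W ω') ∂ν) • g ω) ν := by
    refine Integrable.mono' (hg.norm.const_mul (exp (2 * w)))
      (((Real.measurable_exp.comp hWm).div_const _).aestronglyMeasurable.smul hg.aestronglyMeasurable)
      (ae_of_all _ fun ω => ?_)
    rw [norm_smul, Real.norm_eq_abs, abs_of_nonneg (by positivity)]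
    refine mul_le_mul_of_nonneg_right ?_ (norm_nonneg _)
    have := abs_tiltDensity_sub_one_le (ν := ν) hWm hW ω
    rw [abs_le] at this; linarith
  rw [← integral_sub hint hg]
  have hpt : ∀ ω, |(exp (W ω) / ∫ ω', exp (W ω') ∂ν) • g ω - g ω| ≤ M * (exp (2 * w) - 1) := fun ω => by
    rw [smul_eq_mul, show exp (W ω) / (∫ ω', exp (W ω') ∂ν) * g ω - g ω =
      (exp (W ω) / (∫ ω', exp (W ω') ∂ν) - 1) * g ω by ring, abs_mul]
    calc |exp (W ω) / (∫ ω', exp (W ω') ∂ν) - 1| * |g ω| ≤ (exp (2 * w) - 1) * M :=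
          mul_le_mul (abs_tiltDensity_sub_one_le (ν := ν) hWm hW ω) (hM ω) (abs_nonneg _)
            ((abs_nonneg _).trans (abs_tiltDensity_sub_one_le (ν := ν) hWm hW ω))
      _ = M * (exp (2 * w) - 1) := mul_comm _ _
  calc |∫ ω, (exp (W ω) / ∫ ω', exp (W ω') ∂ν) • g ω - g ω ∂ν|
      ≤ ∫ ω, |(exp (W ω) / ∫ ω', exp (W ω') ∂ν) • g ω - g ω| ∂ν := abs_integral_le_integral_abs
    _ ≤ ∫ _, M * (exp (2 * w) - 1) ∂ν := by
        refine integral_mono_of_nonneg (ae_of_all _ fun _ => abs_nonneg _) (integrable_const _) (ae_of_all _ hpt)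
    _ = M * (exp (2 * w) - 1) := by simp

/-- **A bounded tilt moves a bounded connected two-point function by at most `3·Mf·Mg·(e^{2w} − 1)`** (two-point function in
the form `∫fg − ∫f∫g` of `boxPlaqCov`). -/
theorem abs_cov_tilted_sub_le (hWm : Measurable W) (hW : ∀ ω, |W ω| ≤ w) {f g : Ω → ℝ}
    (hf : Integrable f ν) (hg : Integrable g ν) (hfg : Integrable (fun ω => f ω * g ω) ν)
    {Mf Mg : ℝ} (hMf : ∀ ω, |f ω| ≤ Mf) (hMg : ∀ ω, |g ω| ≤ Mg) :
    |((∫ ω, f ω * g ω ∂(ν.tilted W)) - (∫ ω, f ω ∂(ν.tilted W)) * (∫ ω, g ω ∂(ν.tilted W))) -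
        ((∫ ω, f ω * g ω ∂ν) - (∫ ω, f ω ∂ν) * (∫ ω, g ω ∂ν))| ≤ 3 * Mf * Mg * (exp (2 * w) - 1) := by
  have hne : Nonempty Ω := by
    by_contra h
    rw [not_nonempty_iff] at h
    have h1 : ν (Set.univ : Set Ω) = 1 := measure_univ
    rw [Set.univ_eq_empty_iff.2 h, measure_empty] at h1
    exact zero_ne_one h1
  obtain ⟨ω₀⟩ := hne
  have hMf0 : 0 ≤ Mf := (abs_nonneg _).trans (hMf ω₀)
  have hMg0 : 0 ≤ Mg := (abs_nonneg _).trans (hMg ω₀)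
  have hκ : 0 ≤ exp (2 * w) - 1 := (abs_nonneg _).trans (abs_tiltDensity_sub_one_le (ν := ν) hWm hW ω₀)
  have e1 := abs_integral_tilted_sub_le hWm hW hfg (M := Mf * Mg) fun ω => by
    rw [abs_mul]; exact mul_le_mul (hMf ω) (hMg ω) (abs_nonneg _) hMf0
  have e2 := abs_integral_tilted_sub_le hWm hW hf hMf
  have e3 := abs_integral_tilted_sub_le hWm hW hg hMg
  have mg : |∫ ω, g ω ∂ν| ≤ Mg := by
    calc |∫ ω, g ω ∂ν| ≤ ∫ ω, |g ω| ∂ν := abs_integral_le_integral_abs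
      _ ≤ ∫ _, Mg ∂ν := integral_mono hg.abs (integrable_const _) hMg
      _ = Mg := by simp
  have mf' : |∫ ω, f ω ∂(ν.tilted W)| ≤ Mf := by
    have := abs_sub_abs_le_abs_sub (∫ ω, f ω ∂(ν.tilted W)) (∫ ω, f ω ∂ν)
    calc |∫ ω, f ω ∂(ν.tilted W)| ≤ ∫ ω, |f ω| ∂(ν.tilted W) := abs_integral_le_integral_abs
      _ ≤ Mf := by
          rw [integral_tilted]
          have hZ := integral_exp_mem_Icc (ν := ν) hWm hW
          have hZ0 : 0 < ∫ ω', exp (W ω') ∂ν := lt_of_lt_of_le (exp_pos _) hZ.1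
          have hdens : Integrable (fun ω => exp (W ω) / ∫ ω', exp (W ω') ∂ν) ν := by
            refine Integrable.mono' (integrable_const (exp w / ∫ ω', exp (W ω') ∂ν))
              ((Real.measurable_exp.comp hWm).div_const _).aestronglyMeasurable (ae_of_all _ fun ω => ?_)
            rw [Real.norm_eq_abs, abs_of_nonneg (by positivity)]
            exact div_le_div_of_nonneg_right (exp_le_exp.2 (le_of_abs_le (hW ω))) hZ0.le
          calc ∫ ω, (exp (W ω) / ∫ ω', exp (W ω') ∂ν) • |f ω| ∂ν
              ≤ ∫ ω, (exp (W ω) / ∫ ω', exp (W ω') ∂ν) * Mf ∂ν := by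
                refine integral_mono_of_nonneg (ae_of_all _ fun ω => by positivity) (hdens.mul_const _)
                  (ae_of_all _ fun ω => ?_)
                simp only [smul_eq_mul]
                exact mul_le_mul_of_nonneg_left (hMf ω) (by positivity)
            _ = (∫ ω, exp (W ω) / ∫ ω', exp (W ω') ∂ν ∂ν) * Mf := integral_mul_const _ _
            _ = Mf := by rw [integral_div, div_self hZ0.ne', one_mul]
  set A' := ∫ ω, f ω * g ω ∂(ν.tilted W); set A := ∫ ω, f ω * g ω ∂ν
  set B' := ∫ ω, f ω ∂(ν.tilted W); set B := ∫ ω, f ω ∂ν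
  set C' := ∫ ω, g ω ∂(ν.tilted W); set C := ∫ ω, g ω ∂ν
  set κ := exp (2 * w) - 1
  have halg : (A' - B' * C') - (A - B * C) = (A' - A) - B' * (C' - C) - C * (B' - B) := by ring
  rw [halg]
  calc |(A' - A) - B' * (C' - C) - C * (B' - B)|
      ≤ |A' - A| + |B' * (C' - C)| + |C * (B' - B)| := by
        have := abs_sub (A' - A - B' * (C' - C)) (C * (B' - B))
        have := abs_sub (A' - A) (B' * (C' - C))
        linarith
    _ ≤ Mf * Mg * κ + Mf * (Mg * κ) + Mg * (Mf * κ) := by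
        have h2 : |B' * (C' - C)| ≤ Mf * (Mg * κ) := by
          rw [abs_mul]; exact mul_le_mul mf' e3 (abs_nonneg _) hMf0
        have h3 : |C * (B' - B)| ≤ Mg * (Mf * κ) := by
          rw [abs_mul]; exact mul_le_mul mg e2 (abs_nonneg _) hMg0
        exact add_le_add (add_le_add e1 h2) h3
    _ = 3 * Mf * Mg * κ := by ring

end Summit.QuantumFields.YangMills.Theorems.WeakCouplingRates

end
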